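import Literature.MathematicalPhysics.QuantumFieldTheory.Balaban1983to89.B11Eq98V0LettersUniform
import Literature.MathematicalPhysics.QuantumFieldTheory.Balaban1983to89.B9Eq3152ThirdWordGradRowOfHessianRows

/-!
# `Balaban1983to89.B11Eq98V0LettersLatticeUniform` — T. Bałaban, *The variational problem and background fields in renormalization group method for
# lattice gauge theories*, Commun. Math. Phys. **102** (1985) 277–309 [Balaban1985Variational]: (90)–(96) pp. 291–292 (the V₀-group of `(δ/δA′)V`), (38)
# p. 284, Prop. 4 (97)–(98) p. 293 *«The constants a₃, C₄ depend on d and L only»* — with [Balaban1985BackgroundPropagators] (3.35) p. 396 (print's plaquette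
# window `|U(∂p) − 1| < α₀η²`): **THE V₀-GROUP's (98)-LETTER `C_V` CHOSEN BEFORE THE LATTICE — ON PRINT's SMALL-FIELD CLASS (`U(b) ∈ U1`, `‖U(∂p) − 1‖ ≤ αη²`)
# AND A BOUNDED (115) WEIGHT PROFILE, ONE EXPLICIT `C_V(d, ‖ρ‖, ‖τ‖, α, ω, Ω)` SERVES `QuadAnalytic (curV0 ρ τ U) C_V (1/16)` FOR EVERY LATTICE AND EVERY
# SUCH BACKGROUND** — the lattice-uniform sequel of this lineage's `B11Eq98V0LettersUniform` (gen 69: ONE `C_V(lattice)` for every unit-bounded background — its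
# (38)-letter `K = 2‖τ‖·w²∕η²` carries the lattice because it uses `‖Re W − 1‖ ≤ 2` only; here the plaquette window gives `‖Re U(∂p) − 1‖, ‖Im U(∂p)‖ ≤ αη²`,
# so `K := α‖τ‖ω²`, and the level-geometry letter `Λ` is `ωΩ` from the weight-profile bounds); STOREY I of the NE9 (117)∕(103) programme — the V₀ part of the
# (L3) slot of the lattice-uniform k-level chart `Support/NE9CurChartTowerPiLatticeUniformClass`

statement-level skeleton of published theorems with citation tags; proofs where landed; nothing here is a claim about the Yang–Mills mass gap

CITATION HEADER (lean-in-tree rule).  Audit cell `pub-balaban`, sub-cell `t4`, BINDER row NE9; NE9 crux-team LEAF PROVER 01 (`b2b-balaban-t4-ne9-formalise-leaf-01`, gen 96;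
(I-11); bears_on: R4/N22).  Source read through the verbatim quotations of `B11Eq98V0LettersUniform` ∕ `B11Eq63V0GroupCurrent` (`paper:balaban1985-cmp102-variational-background`
pp. 284, 291–293) and of `B9Eq3152ThirdWordGradRowOfHessianRows` (`paper:balaban1985-cmp99-background-propagators` p. 396 (3.35)).  Composed BY NAME: ne9-leaf-05 g64's
`B11Eq63V0GroupCurrent.quadAnalytic_curV0` (the estimate), `B11Eq98V0LettersUniform.plaqU_mem_U1 ∕ traceSlotsW_of_contractive`, this lineage's gen-95
`B9Eq3152ThirdWordGradRowOfHessianRows.norm_plaqU_sub_one_le_of_plaqHolU` (the torus plaquette window at all index pairs).  Nothing of [B11]'s inequalities asserted.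

WHAT IS PROVED (sorry-free; proof lane — 0 `def`; [folklore] bookkeeping).
* §1 **`norm_reC_sub_one_le_of_near_one`**, **`norm_imC_le_of_near_one`** — `W ∈ U1`, `‖W − 1‖ ≤ ε` ⟹ `‖Re W − 1‖ ≤ ε`, `‖Im W‖ ≤ ε`.
* §2 **`traceSlotK_of_plaq_window`** — for `U(b) ∈ U1` with `‖U(∂p) − 1‖ ≤ αη²` (all plaquettes of the torus) and `w̄₀ = wSup (levWeight L η lev₀ 1) ≤ ω`: the (38)-slots `hRe1`,
  `hIm` of `quadAnalytic_curV0` hold with `K := α‖τ‖ω²` — NO `η`, NO lattice.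
* §3 **`levelGeometry_of_weight_bounds`** — `w̄₀ ≤ ω`, `w̲₀,₁⁻¹ ≤ Ω`, `w̲₁,₂⁻¹ ≤ Ω` (`1 ≤ ω`, `1 ≤ Ω`) ⟹ the three level-geometry letters `hΛ`, `hΛa`, `hΛ′` with `Λ := ωΩ`.
* §4 **`quadAnalytic_curV0_lattice_uniform`** — `QuadAnalytic (curV0 ρ τ U) C_V (1/16)` with the EXPLICIT, lattice-free
  `C_V = 1024(d−1)(ωΩ)³‖ρ‖(α‖τ‖ω² + 1/16) + (d−1)(ωΩ)³(136 + 2ωΩ)‖ρ‖‖τ‖` for EVERY lattice, every unitary `U1`-valued background in the plaquette window and every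
  weight profile within the bounds; **`curV0_quadBound_lattice_uniform`** — the consumer-ready `∀ Y, ‖Y‖ < 1/16 → ‖curV0 ρ τ U Y‖ ≤ C_V‖Y‖²`.
HONEST SCOPE.  The V₀-GROUP ONLY: the Sect. D groups' kernel-column letters of `W80` (`B11Ineq73KernelLettersPerLattice`) stay per lattice, so the full (L3) slot
`W80` is NOT yet lattice-uniform; the plaquette window, `U1`-values, unitarity, the trace letters and the weight bounds are HYPOTHESES; `C_V` crude, NOT print's `C₄(d, L)`.  NOT NE9 (cell
pub-balaban: NE9 NOT PRINTED ∕ NOT PROVED; «NE9 ⇐ the named binders»; row WALLED ON A MODEL (O-NE9-1; #5 UNRULED); spine PROVED 0∕9; rung (B)+1 on a finite T⁴ — NOT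
infinite volume, NOT mass gap, NOT BetaPertH, NOT Clay; HONEST DEPENDENCY: continuum YM on T⁴ ⇐ BetaPertH ∧ nine spine estimates (0/9 proved); BetaPertH ⇐ (D1) ∧ (D4) ∧
CAP+tail; G-an2-4 gates asym, D1 and NE2/3/4).  NEW file; nothing modified.  Net new unproved facts: 0.
-/

noncomputable section

open scoped BigOperators
namespace Literature.MathematicalPhysics.QuantumFieldTheory.Balaban1983to89.B11Eq98V0LettersLatticeUniform

open Literature.MathematicalPhysics.QuantumFieldTheory.Balaban1983to89.B9Eq37Insertion (reC imC)
open Literature.MathematicalPhysics.QuantumFieldTheory.Balaban1983to89.B9Eq39Adjoint (posPlaq plaqU)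
open Literature.MathematicalPhysics.QuantumFieldTheory.Balaban1983to89.B11Eq90StB (st)
open Literature.MathematicalPhysics.QuantumFieldTheory.Balaban1983to89.B11Eq90V0primeBond (plaqWeight plaqWeight_pos plaqWeight_le₁)
open Literature.MathematicalPhysics.QuantumFieldTheory.Balaban1983to89.B11Eq90V0primeCurrent (Tsh Ucur)
open Literature.MathematicalPhysics.QuantumFieldTheory.Balaban1983to89.B11Eq63V0GroupCurrent (curV0 quadAnalytic_curV0)
open Literature.MathematicalPhysics.QuantumFieldTheory.Balaban1983to89.B11Eq98V0LettersUniform (plaqU_mem_U1 traceSlotsW_of_contractive)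
open Literature.MathematicalPhysics.QuantumFieldTheory.Balaban1983to89.B9Eq3152ThirdWordGradRowOfHessianRows (norm_plaqU_sub_one_le_of_plaqHolU)
open Literature.MathematicalPhysics.QuantumFieldTheory.Balaban1983to89.B13Contraction113 (QuadAnalytic)
open B7Prop1Explicit (U1 mem_U1)
open B9SectCLatticeCarrier (Bond)
open B9Eq310DeltaPrime (plaqHolU)
open B4Sect5Torus (TSite)
open B11Eq115Space
open B11Eq111FrakG (nabla115)

/-! ## §1 `Re`, `Im` of a unit near `1` -/

section NearOne

variable {𝔸 : Type*} [NormedRing 𝔸] [NormedAlgebra ℂ 𝔸] [NormOneClass 𝔸]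

omit [NormedAlgebra ℂ 𝔸] in
/-- `W ∈ U1`, `‖W − 1‖ ≤ ε` ⟹ `‖W⁻¹ − 1‖ ≤ ε` (`W⁻¹ − 1 = W⁻¹(1 − W)`, `‖W⁻¹‖ ≤ 1`) — the elementary step behind (38)'s `|U(∂p)⁻¹ − 1|`. [folklore]
[cite: Balaban1985Variational, (38) p.284] -/
theorem norm_inv_sub_one_le_of_near_one {W : 𝔸ˣ} (hW : W ∈ U1 𝔸) {ε : ℝ} (hε : ‖(W : 𝔸) - 1‖ ≤ ε) : ‖((W⁻¹ : 𝔸ˣ) : 𝔸) - 1‖ ≤ ε := by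
  obtain ⟨-, h2⟩ := mem_U1.1 hW
  have e : ((W⁻¹ : 𝔸ˣ) : 𝔸) - 1 = ((W⁻¹ : 𝔸ˣ) : 𝔸) * (1 - (W : 𝔸)) := by
    rw [mul_sub, mul_one, Units.inv_mul]
  rw [e]
  calc ‖((W⁻¹ : 𝔸ˣ) : 𝔸) * (1 - (W : 𝔸))‖ ≤ ‖((W⁻¹ : 𝔸ˣ) : 𝔸)‖ * ‖1 - (W : 𝔸)‖ := norm_mul_le _ _
    _ ≤ 1 * ε := mul_le_mul h2 (by rwa [norm_sub_rev]) (norm_nonneg _) zero_le_one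
    _ = ε := one_mul ε

/-- **`‖Re W − 1‖ ≤ ε` for `W ∈ U1` with `‖W − 1‖ ≤ ε`** (`Re W − 1 = ½((W − 1) + (W⁻¹ − 1))`). [folklore] [cite: Balaban1985Variational, (38) p.284] -/
theorem norm_reC_sub_one_le_of_near_one {W : 𝔸ˣ} (hW : W ∈ U1 𝔸) {ε : ℝ} (hε : ‖(W : 𝔸) - 1‖ ≤ ε) : ‖reC W - 1‖ ≤ ε := by
  have e : reC W - 1 = (2 : ℂ)⁻¹ • (((W : 𝔸) - 1) + (((W⁻¹ : 𝔸ˣ) : 𝔸) - 1)) := by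
    unfold reC
    have h2 : (1 : 𝔸) = (2 : ℂ)⁻¹ • ((1 : 𝔸) + 1) := by
      rw [← two_smul ℂ (1 : 𝔸), smul_smul, inv_mul_cancel₀ (two_ne_zero), one_smul]
    conv_lhs => rw [h2]
    rw [← smul_sub]; congr 1; abel
  rw [e, norm_smul, norm_inv, Complex.norm_two]
  calc 2⁻¹ * ‖((W : 𝔸) - 1) + (((W⁻¹ : 𝔸ˣ) : 𝔸) - 1)‖ ≤ 2⁻¹ * (ε + ε) :=
        mul_le_mul_of_nonneg_left ((norm_add_le _ _).trans (add_le_add hε (norm_inv_sub_one_le_of_near_one hW hε))) (by norm_num)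
    _ = ε := by ring

/-- **`‖Im W‖ ≤ ε` for `W ∈ U1` with `‖W − 1‖ ≤ ε`** (`Im W = (2i)⁻¹((W − 1) − (W⁻¹ − 1))`). [folklore] [cite: Balaban1985Variational, (38) p.284] -/
theorem norm_imC_le_of_near_one {W : 𝔸ˣ} (hW : W ∈ U1 𝔸) {ε : ℝ} (hε : ‖(W : 𝔸) - 1‖ ≤ ε) : ‖imC W‖ ≤ ε := by
  have e : imC W = (2 * Complex.I)⁻¹ • (((W : 𝔸) - 1) - (((W⁻¹ : 𝔸ˣ) : 𝔸) - 1)) := by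
    unfold imC; congr 1; abel
  rw [e, norm_smul, norm_inv, norm_mul, Complex.norm_two, Complex.norm_I, mul_one]
  calc 2⁻¹ * ‖((W : 𝔸) - 1) - (((W⁻¹ : 𝔸ˣ) : 𝔸) - 1)‖ ≤ 2⁻¹ * (ε + ε) :=
        mul_le_mul_of_nonneg_left ((norm_sub_le _ _).trans (add_le_add hε (norm_inv_sub_one_le_of_near_one hW hε))) (by norm_num)
    _ = ε := by ring

end NearOne

/-! ## §2 The (38)-letter `K` from the PLAQUETTE WINDOW — lattice-free -/

variable {d : ℕ} {Pd : Fin d → ℕ} {L η : ℝ} [Fact (0 < L)] [Fact (0 < η)]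
variable {𝔸 : Type*} [NormedRing 𝔸] [NormedAlgebra ℂ 𝔸] [NormOneClass 𝔸]

/-- **THE (38)-TYPE TRACE SLOTS WITH `K := α‖τ‖ω²`, NO `η`, NO LATTICE**: for `U(b) ∈ U1` in the torus plaquette window `‖U(∂p) − 1‖ ≤ αη²` and a weight
profile with `wSup (levWeight L η lev₀ 1) ≤ ω`: `‖τ(Z·(Re U(∂q) − 1))‖ ≤ ‖Z‖·η²·(K∕w_∂(q)²)`, `‖τ(Z·η⁻²Im U(∂q))‖ ≤ ‖Z‖·(K∕w_∂(q)²)` on the positively oriented plaquettes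
(`w_∂(q) ≤ w̄₀ ≤ ω`). [cite: Balaban1985Variational, (38) p.284, (90) p.291; Balaban1985BackgroundPropagators, (3.35) p.396] -/
theorem traceSlotK_of_plaq_window (τ : 𝔸 →L[ℂ] ℂ) (lev₀ : Bond d Pd → ℕ) {U : Bond d Pd → 𝔸ˣ} (hUb : ∀ b, U b ∈ U1 𝔸) {α : ℝ} (hα : 0 ≤ α)
    (hpl : ∀ p : B9SectCLatticeCarrier.Plaq d Pd, ‖(plaqHolU U p : 𝔸) - 1‖ ≤ α * η ^ 2) {ω : ℝ} (hω : (NegSup.wSup (levWeight L η lev₀ 1) : ℝ) ≤ ω) :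
    (∀ q ∈ posPlaq (TSite d Pd) (Fin d), ∀ Z : 𝔸,
        ‖(τ : 𝔸 →ₗ[ℂ] ℂ) (Z * (reC (plaqU Tsh (Ucur U) q.2.1 q.2.2 q.1) - 1))‖
          ≤ ‖Z‖ * (η ^ 2 * (α * ‖τ‖ * ω ^ 2 / plaqWeight Tsh (levWeight L η lev₀ 1) q ^ 2))) ∧
    (∀ q ∈ posPlaq (TSite d Pd) (Fin d), ∀ Z : 𝔸,
        ‖(τ : 𝔸 →ₗ[ℂ] ℂ) (Z * (((η : ℂ) ^ 2)⁻¹ • imC (plaqU Tsh (Ucur U) q.2.1 q.2.2 q.1)))‖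
          ≤ ‖Z‖ * (α * ‖τ‖ * ω ^ 2 / plaqWeight Tsh (levWeight L η lev₀ 1) q ^ 2)) := by
  have hη : (0 : ℝ) < η := Fact.out
  have hw : ∀ b : Bond d Pd, 0 < levWeight L η lev₀ 1 b := levWeight_pos (Fact.out : 0 < L) hη lev₀ 1
  have hpw : ∀ q, 0 < plaqWeight Tsh (levWeight L η lev₀ 1) q := plaqWeight_pos Tsh hw
  -- the plaquette weight is below `ω`, so `1 ≤ ω²∕w_∂(q)²`
  have hratio : ∀ q, 1 ≤ ω ^ 2 / plaqWeight Tsh (levWeight L η lev₀ 1) q ^ 2 := fun q => by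
    have h1 : plaqWeight Tsh (levWeight L η lev₀ 1) q ≤ ω :=
      (plaqWeight_le₁ Tsh (levWeight L η lev₀ 1) q).trans ((NegSup.le_wSup (w := levWeight L η lev₀ 1) _).trans hω)
    rw [le_div_iff₀ (pow_pos (hpw q) 2), one_mul]
    exact pow_le_pow_left₀ (hpw q).le h1 2
  -- the generic estimate `‖τ(Z·X)‖ ≤ ‖τ‖·‖X‖·‖Z‖`
  have key : ∀ Z X : 𝔸, ‖(τ : 𝔸 →ₗ[ℂ] ℂ) (Z * X)‖ ≤ ‖τ‖ * ‖X‖ * ‖Z‖ := fun Z X => by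
    calc ‖(τ : 𝔸 →ₗ[ℂ] ℂ) (Z * X)‖ = ‖τ (Z * X)‖ := rfl
      _ ≤ ‖τ‖ * ‖Z * X‖ := τ.le_opNorm _
      _ ≤ ‖τ‖ * (‖Z‖ * ‖X‖) := by gcongr; exact norm_mul_le _ _
      _ = ‖τ‖ * ‖X‖ * ‖Z‖ := by ring
  -- the plaquette window at ALL index pairs
  have hwin : ∀ (κ ν : Fin d) (x : TSite d Pd), ‖((plaqU Tsh (Ucur U) κ ν x : 𝔸ˣ) : 𝔸) - 1‖ ≤ α * η ^ 2 :=
    norm_plaqU_sub_one_le_of_plaqHolU U hUb (by positivity) hpl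
  have hmem : ∀ (κ ν : Fin d) (x : TSite d Pd), plaqU Tsh (Ucur U) κ ν x ∈ U1 𝔸 := fun κ ν x => plaqU_mem_U1 hUb κ ν x
  refine ⟨fun q _ Z => ?_, fun q _ Z => ?_⟩
  · calc _ ≤ ‖τ‖ * ‖reC (plaqU Tsh (Ucur U) q.2.1 q.2.2 q.1) - 1‖ * ‖Z‖ := key Z _
      _ ≤ ‖τ‖ * (α * η ^ 2) * ‖Z‖ := by gcongr; exact norm_reC_sub_one_le_of_near_one (hmem _ _ _) (hwin _ _ _)
      _ = ‖Z‖ * (η ^ 2 * (α * ‖τ‖)) * 1 := by ring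
      _ ≤ ‖Z‖ * (η ^ 2 * (α * ‖τ‖)) * (ω ^ 2 / plaqWeight Tsh (levWeight L η lev₀ 1) q ^ 2) :=
          mul_le_mul_of_nonneg_left (hratio q) (by positivity)
      _ = ‖Z‖ * (η ^ 2 * (α * ‖τ‖ * ω ^ 2 / plaqWeight Tsh (levWeight L η lev₀ 1) q ^ 2)) := by ring
  · have him : ‖((η : ℂ) ^ 2)⁻¹ • imC (plaqU Tsh (Ucur U) q.2.1 q.2.2 q.1)‖ ≤ α := by
      rw [norm_smul, norm_inv, norm_pow, Complex.norm_real, Real.norm_eq_abs, abs_of_pos hη]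
      calc (η ^ 2)⁻¹ * ‖imC (plaqU Tsh (Ucur U) q.2.1 q.2.2 q.1)‖ ≤ (η ^ 2)⁻¹ * (α * η ^ 2) :=
            mul_le_mul_of_nonneg_left (norm_imC_le_of_near_one (hmem _ _ _) (hwin _ _ _)) (by positivity)
        _ = α := by field_simp
    calc _ ≤ ‖τ‖ * ‖((η : ℂ) ^ 2)⁻¹ • imC (plaqU Tsh (Ucur U) q.2.1 q.2.2 q.1)‖ * ‖Z‖ := key Z _
      _ ≤ ‖τ‖ * α * ‖Z‖ := by gcongr
      _ = ‖Z‖ * (α * ‖τ‖) * 1 := by ring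
      _ ≤ ‖Z‖ * (α * ‖τ‖) * (ω ^ 2 / plaqWeight Tsh (levWeight L η lev₀ 1) q ^ 2) :=
          mul_le_mul_of_nonneg_left (hratio q) (by positivity)
      _ = ‖Z‖ * (α * ‖τ‖ * ω ^ 2 / plaqWeight Tsh (levWeight L η lev₀ 1) q ^ 2) := by ring

/-! ## §3 The level-geometry letter `Λ := ωΩ` from the weight-profile bounds -/

omit [NormedAlgebra ℂ 𝔸] [NormOneClass 𝔸] in
/-- **`Λ := ωΩ` SERVES THE THREE LEVEL-GEOMETRY LETTERS OF `quadAnalytic_curV0`** whenever `w̄₀ ≤ ω`, `w̲₀,₁⁻¹ ≤ Ω` (the `lev₀` weights at exponent `1`) and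
`w̲₁,₂⁻¹ ≤ Ω` (the `lev₁` weights at exponent `2`), `1 ≤ ω`, `1 ≤ Ω`: every weight is in `[Ω⁻¹, ω]`, so any two are within the factor `ωΩ`, and a square within
`(ωΩ)²`. [folklore] [cite: Balaban1985Variational, (115) p.294, p.286] -/
theorem levelGeometry_of_weight_bounds (lev₀ : Bond d Pd → ℕ) (lev₁ : Bond d Pd × Fin d → ℕ) {ω Ω : ℝ} (hω1 : 1 ≤ ω) (hΩ1 : 1 ≤ Ω)
    (hω : (NegSup.wSup (levWeight L η lev₀ 1) : ℝ) ≤ ω) (hΩ₀ : (NegSup.wInvSup (levWeight L η lev₀ 1) : ℝ) ≤ Ω)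
    (hΩ₁ : (NegSup.wInvSup (levWeight L η lev₁ 2) : ℝ) ≤ Ω) :
    1 ≤ ω * Ω ∧
    (∀ q ∈ posPlaq (TSite d Pd) (Fin d), ∀ (μ₀ : Fin d) (x₀ : TSite d Pd), q ∈ st Tsh μ₀ x₀ →
      levWeight L η lev₀ 1 (x₀, μ₀) ≤ ω * Ω * plaqWeight Tsh (levWeight L η lev₀ 1) q) ∧
    (∀ (x₀ : TSite d Pd) (μ₀ ν : Fin d) (y : TSite d Pd), (y = x₀ ∨ y = (Tsh ν).symm x₀) →
      levWeight L η lev₀ 1 (x₀, μ₀) ≤ ω * Ω * levWeight L η lev₀ 1 (y, μ₀) ∧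
        levWeight L η lev₀ 1 (x₀, μ₀) ≤ ω * Ω * levWeight L η lev₀ 1 (y, ν)) ∧
    (∀ (x₀ : TSite d Pd) (μ₀ ν : Fin d) (y : TSite d Pd), (y = x₀ ∨ y = (Tsh ν).symm x₀) →
      ∀ κ κ'' : Fin d, (κ = μ₀ ∨ κ = ν) → (κ'' = μ₀ ∨ κ'' = ν) →
        levWeight L η lev₀ 1 (x₀, μ₀) ^ 2 ≤ (ω * Ω) ^ 2 * levWeight L η lev₁ 2 ((y, κ), κ'')) := by
  have hη : (0 : ℝ) < η := Fact.out
  have hL : (0 : ℝ) < L := Fact.out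
  have hw₀ : ∀ b : Bond d Pd, 0 < levWeight L η lev₀ 1 b := levWeight_pos hL hη lev₀ 1
  have hw₁ : ∀ b : Bond d Pd × Fin d, 0 < levWeight L η lev₁ 2 b := levWeight_pos hL hη lev₁ 2
  have hΩ0 : 0 < Ω := lt_of_lt_of_le one_pos hΩ1
  have hω0 : 0 < ω := lt_of_lt_of_le one_pos hω1
  -- every weight lies in `[Ω⁻¹, ω]`
  have hup : ∀ b, levWeight L η lev₀ 1 b ≤ ω := fun b => (NegSup.le_wSup (w := levWeight L η lev₀ 1) b).trans hω
  have hlow₀ : ∀ b, Ω⁻¹ ≤ levWeight L η lev₀ 1 b := fun b => by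
    have h := (NegSup.inv_le_wInvSup (w := levWeight L η lev₀ 1) b).trans hΩ₀
    rwa [inv_le_comm₀ (hw₀ b) hΩ0] at h
  have hlow₁ : ∀ b, Ω⁻¹ ≤ levWeight L η lev₁ 2 b := fun b => by
    have h := (NegSup.inv_le_wInvSup (w := levWeight L η lev₁ 2) b).trans hΩ₁
    rwa [inv_le_comm₀ (hw₁ b) hΩ0] at h
  -- any `lev₀` weight against anything `≥ Ω⁻¹`
  have hpair : ∀ (b : Bond d Pd) {t : ℝ}, Ω⁻¹ ≤ t → levWeight L η lev₀ 1 b ≤ ω * Ω * t := fun b t ht => by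
    calc levWeight L η lev₀ 1 b ≤ ω := hup b
      _ = ω * Ω * Ω⁻¹ := by field_simp
      _ ≤ ω * Ω * t := mul_le_mul_of_nonneg_left ht (by positivity)
  have hplaq : ∀ q, Ω⁻¹ ≤ plaqWeight Tsh (levWeight L η lev₀ 1) q := fun q => by
    unfold plaqWeight
    exact le_min (le_min (hlow₀ _) (hlow₀ _)) (le_min (hlow₀ _) (hlow₀ _))
  refine ⟨one_le_mul_of_one_le_of_one_le hω1 hΩ1, fun q _ μ₀ x₀ _ => hpair _ (hplaq q), fun x₀ μ₀ ν y _ => ⟨hpair _ (hlow₀ _), hpair _ (hlow₀ _)⟩,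
    fun x₀ μ₀ ν y _ κ κ'' _ _ => ?_⟩
  have h1 : levWeight L η lev₀ 1 (x₀, μ₀) ^ 2 ≤ ω ^ 2 := pow_le_pow_left₀ (hw₀ _).le (hup _) 2
  have h2 : ω ^ 2 ≤ (ω * Ω) ^ 2 * levWeight L η lev₁ 2 ((y, κ), κ'') := by
    calc ω ^ 2 = (ω * Ω) ^ 2 * (Ω⁻¹ * Ω⁻¹) := by field_simp
      _ ≤ (ω * Ω) ^ 2 * (Ω⁻¹ * 1) := mul_le_mul_of_nonneg_left (mul_le_mul_of_nonneg_left (inv_le_one_of_one_le₀ hΩ1) (by positivity)) (by positivity)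
      _ = (ω * Ω) ^ 2 * Ω⁻¹ := by ring
      _ ≤ (ω * Ω) ^ 2 * levWeight L η lev₁ 2 ((y, κ), κ'') := mul_le_mul_of_nonneg_left (hlow₁ _) (by positivity)
  exact h1.trans h2

/-! ## §4 The V₀-group's (98)-letter BEFORE the lattice -/

/-- **`QuadAnalytic (curV0 ρ τ U) C_V (1/16)` WITH ONE EXPLICIT, LATTICE-FREE `C_V`** for EVERY lattice `T_{Pd}` with (115) parameters `(L, η)`, every
`U1`-valued unitary background in the torus plaquette window `‖U(∂p) − 1‖ ≤ αη²`, and every weight profile with `w̄₀ ≤ ω`, `w̲₀,₁⁻¹, w̲₁,₂⁻¹ ≤ Ω`: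
`C_V = 1024(d−1)(ωΩ)³‖ρ‖(α‖τ‖ω² + 1/16) + (d−1)(ωΩ)³(136 + 2ωΩ)‖ρ‖‖τ‖` — ne9-leaf-05's `quadAnalytic_curV0` at `K := α‖τ‖ω²` (§2), `Λ := ωΩ` (§3), the (31)-slots from
a contractive trace. [cite: Balaban1985Variational, (98) p.293, (90)–(96) pp.291–292; Balaban1985BackgroundPropagators, (3.35) p.396] -/
theorem quadAnalytic_curV0_lattice_uniform {lev₀ : Bond d Pd → ℕ} {lev₁ : Bond d Pd × Fin d → ℕ} [CompleteSpace 𝔸] [StarRing 𝔸] [StarModule ℂ 𝔸]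
    (ρ : (𝔸 →L[ℂ] ℂ) →L[ℂ] 𝔸) (τ : 𝔸 →L[ℂ] ℂ) (hτ : ∀ a b : 𝔸, τ (a * b) = τ (b * a)) (hτs : ∀ a : 𝔸, τ (star a) = starRingEnd ℂ (τ a))
    (hτ1 : ∀ X : 𝔸, ‖τ X‖ ≤ ‖X‖) (hL : 1 ≤ L) {U : Bond d Pd → 𝔸ˣ} (hUb : ∀ b, U b ∈ U1 𝔸) (hUst : ∀ b, (((U b)⁻¹ : 𝔸ˣ) : 𝔸) = star (U b : 𝔸))
    {α : ℝ} (hα : 0 ≤ α) (hpl : ∀ p : B9SectCLatticeCarrier.Plaq d Pd, ‖(plaqHolU U p : 𝔸) - 1‖ ≤ α * η ^ 2)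
    {ω Ω : ℝ} (hω1 : 1 ≤ ω) (hΩ1 : 1 ≤ Ω) (hω : (NegSup.wSup (levWeight L η lev₀ 1) : ℝ) ≤ ω)
    (hΩ₀ : (NegSup.wInvSup (levWeight L η lev₀ 1) : ℝ) ≤ Ω) (hΩ₁ : (NegSup.wInvSup (levWeight L η lev₁ 2) : ℝ) ≤ Ω) :
    QuadAnalytic (curV0 (L := L) (η := η) (lev₀ := lev₀) (lev₁ := lev₁) (Dc := nabla115 η U) ρ τ U)
      (1024 * ((d - 1 : ℕ) : ℝ) * (ω * Ω) ^ 3 * ‖ρ‖ * (α * ‖τ‖ * ω ^ 2 + 1 / 16)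
        + ((d - 1 : ℕ) : ℝ) * (ω * Ω) ^ 3 * (136 + 2 * (ω * Ω)) * ‖ρ‖ * ‖τ‖) (1 / 16) := by
  obtain ⟨hΛ1, hΛ, hΛa, hΛ'⟩ := levelGeometry_of_weight_bounds (L := L) (η := η) lev₀ lev₁ hω1 hΩ1 hω hΩ₀ hΩ₁
  obtain ⟨hRe1, hIm⟩ := traceSlotK_of_plaq_window (L := L) (η := η) τ lev₀ hUb hα hpl hω
  have hUn : ∀ b, ‖(U b : 𝔸)‖ ≤ 1 ∧ ‖(((U b)⁻¹ : 𝔸ˣ) : 𝔸)‖ ≤ 1 := fun b => mem_U1.1 (hUb b)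
  obtain ⟨hW, hW'⟩ := traceSlotsW_of_contractive (d := d) (Pd := Pd) τ hτ1 hUn
  exact quadAnalytic_curV0 ρ τ U hUst hUn hτ hτs hL (by positivity) hΛ1 hΛ hΛa hΛ' hRe1 hIm hW hW'

/-- **THE CONSUMER-READY FORM**: under the same letters, `∀ Y, ‖Y‖ < 1/16 → ‖curV0 ρ τ U Y‖ ≤ C_V‖Y‖²` — the V₀ part of the (L3) slot `hqV` of the NE9 chart
faces with ONE `C_V` for every lattice of the tower and every background of print's class. [cite: Balaban1985Variational, (98) p.293] -/
theorem curV0_quadBound_lattice_uniform {lev₀ : Bond d Pd → ℕ} {lev₁ : Bond d Pd × Fin d → ℕ} [CompleteSpace 𝔸] [StarRing 𝔸] [StarModule ℂ 𝔸]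
    (ρ : (𝔸 →L[ℂ] ℂ) →L[ℂ] 𝔸) (τ : 𝔸 →L[ℂ] ℂ) (hτ : ∀ a b : 𝔸, τ (a * b) = τ (b * a)) (hτs : ∀ a : 𝔸, τ (star a) = starRingEnd ℂ (τ a))
    (hτ1 : ∀ X : 𝔸, ‖τ X‖ ≤ ‖X‖) (hL : 1 ≤ L) {U : Bond d Pd → 𝔸ˣ} (hUb : ∀ b, U b ∈ U1 𝔸) (hUst : ∀ b, star (U b : 𝔸) = (((U b)⁻¹ : 𝔸ˣ) : 𝔸))
    {α : ℝ} (hα : 0 ≤ α) (hpl : ∀ p : B9SectCLatticeCarrier.Plaq d Pd, ‖(plaqHolU U p : 𝔸) - 1‖ ≤ α * η ^ 2)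
    {ω Ω : ℝ} (hω1 : 1 ≤ ω) (hΩ1 : 1 ≤ Ω) (hω : (NegSup.wSup (levWeight L η lev₀ 1) : ℝ) ≤ ω)
    (hΩ₀ : (NegSup.wInvSup (levWeight L η lev₀ 1) : ℝ) ≤ Ω) (hΩ₁ : (NegSup.wInvSup (levWeight L η lev₁ 2) : ℝ) ≤ Ω)
    (Y : Space115 L η lev₀ lev₁ (nabla115 η U)) (hY : ‖Y‖ < 1 / 16) :
    ‖curV0 (lev₁ := lev₁) (Dc := nabla115 η U) ρ τ U Y‖ ≤
      (1024 * ((d - 1 : ℕ) : ℝ) * (ω * Ω) ^ 3 * ‖ρ‖ * (α * ‖τ‖ * ω ^ 2 + 1 / 16)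
        + ((d - 1 : ℕ) : ℝ) * (ω * Ω) ^ 3 * (136 + 2 * (ω * Ω)) * ‖ρ‖ * ‖τ‖) * ‖Y‖ ^ 2 :=
  (quadAnalytic_curV0_lattice_uniform (L := L) (η := η) (lev₀ := lev₀) (lev₁ := lev₁) ρ τ hτ hτs hτ1 hL hUb (fun b => (hUst b).symm) hα hpl hω1 hΩ1 hω hΩ₀
    hΩ₁).quad Y hY

end Literature.MathematicalPhysics.QuantumFieldTheory.Balaban1983to89.B11Eq98V0LettersLatticeUniform

end
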